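import Summits.AtomisticToContinuum.BoseEinsteinCondensation.Theorems.BECThomsonPrincipleDensityResponseDefs
import Summits.AtomisticToContinuum.BoseEinsteinCondensation.Theorems.BECInsertionCorrectorStaticResponseBoundTruncationCompactness
import Summits.AtomisticToContinuum.BoseEinsteinCondensation.Theorems.BECGroundStateSOSPeriodicIRBoundWFPotCross
import Literature.MathematicalPhysics.QuantumManyBody.PeriodicMaxFormBound
import HarnessLib

/-!
# Stub S4 `stub_truncationLimit` of line `force-balance-constitutive` (crux `BECThomsonPrinciple.DensityResponse`,
# item stmt-AtomisticToContinuum-9481): the truncation limit at fixed volume for INTEGRABLE pair potentials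

`TruncationLimit` (the registered stub S4, verbatim `…StaticResponseBound…UvThomsonStubs.TruncationLimit` of the
sibling crux stmt-AtomisticToContinuum-12057) asks, for every admissible `v`, `N`, `L > 0` with
`E₀(v) = periodicGroundStateEnergy v N L < ∞` and `ε > 0`, for `n₁` with `E₀(v) ≤ E₀(min(v,n)) + ε` for all
`n ≥ n₁`. The sibling files `…StaticResponseBoundTruncation{Monotone,Compactness}.lean` reduced it to ONE fact,
`MaxFormBound` (the Bose-symmetric periodic `C¹` core realises the infimum of the MAXIMAL form), used there for
ALL `v` at once. Proved here (sorry-free, no new definitions):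

* `truncationLimit_at_of_maxFormBound_at` — the **per-`(v, N, L)` reduction**: the sibling's
  `truncationLimit_of_maxFormBound` consumes `MaxFormBound` only at the given `(v, N, L)` (same proof, with the
  compactness half `exists_limitProfile` imported).
* `truncationLimit_at_of_integrable` — **`TruncationLimit` at `(v, N, L)` whenever the periodic interaction
  `W = ∑_{i<j} v^per(xᵢ - xⱼ)` is integrable on the cell `[0,L)^{3N}`**, by the Literature theorem
  `periodicGroundStateEnergy_le_maxForm` (`Literature/…/QuantumManyBody/PeriodicMaxFormBound.lean`: Simon's
  form-core theorem for integrable interactions in the Bose sector — Lipschitz clamp truncation on the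
  Fourier-side `H¹` (`TorusLipschitzFourierH1`), box-kernel smoothing with sup-norm control
  (`HaarTorusBoundedTrigApprox`), dominated convergence, and the momentum-space dictionary of the `C¹` core
  (`PeriodicFormCoreTrigPoly`)).
* `truncationLimit_at_of_integrable_profile`, `stub_truncationLimit_integrable` — the same with the hypothesis on
  the profile, `∫_{ℝ³} v(|z|) dz < ∞` (`lintegral_cellN_periodicInteraction_ne_top` of the `PeriodicIRBound` files):
  **the registered stub with the single extra hypothesis `∫⁻ z, v ‖z‖ ≠ ⊤`** (covers every bounded and every
  `L¹` finite-range repulsive potential; `E₀(v) ≠ ⊤` is then automatic but kept verbatim).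

NOT proved: the hard-core / non-`L¹` case (`∫_{[0,L)^{3N}} W = ∞` with `E₀(v) < ∞`), i.e. `MaxFormBound` for
interactions whose maximal form domain forces vanishing on the hard set; on paper it needs quasi-continuous
representatives, capacity and Hedberg's synthesis theorem (drefuter's analysis
`Cruxes/StaticResponseBound/Drefute-g3-MaxFormBound.md`), none of which is in Mathlib or the tree. The missing
lemma is recorded verbatim as the hypothesis of `truncationLimit_at_of_maxFormBound_at`.

References: B. Simon, *J. Operator Theory* 1 (1979) 37–47 and *J. Funct. Anal.* 28 (1978) 377–385;
[ReedSimonIV1978] Thm XIII.64; [LSSY2005] App. A.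
-/

noncomputable section

namespace Summit.AtomisticToContinuum.BoseEinsteinCondensation.Cruxes.DensityResponse.ForceBalanceConstitutive

open MeasureTheory Filter UnitAddTorus
open scoped ENNReal NNReal BigOperators Topology InnerProductSpace
open Literature.MathematicalPhysics.QuantumManyBody.BoseGas
open Summit.AtomisticToContinuum.BoseEinsteinCondensation.Cruxes.StaticResponseBound.UvThomsonForceWave

-- The measure on `ℝ/ℤ` is the Haar PROBABILITY measure, as in `PeriodicFormDomain.lean` and the sibling files.
attribute [local instance] Literature.MathematicalPhysics.QuantumManyBody.BoseGas.formDomain_measureSpace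
  Literature.MathematicalPhysics.QuantumManyBody.BoseGas.formDomain_isProbabilityMeasure
  Literature.MathematicalPhysics.QuantumManyBody.BoseGas.formDomain_isProbabilityMeasure_pi

/-! ### The per-`(v, N, L)` reduction -/

/-- **Reduction of the truncation limit at `(v, N, L)` to the maximal-form bound at `(v, N, L)`.** If for every
unit `η ∈ L²((ℝ/ℤ)^{3N})` Bose-symmetric in momentum space the `C¹`-core ground-state energy `E₀(v)` is bounded by
the maximal-form energy of `η`, then `E₀(v) ≤ E₀(min(v,n)) + ε` for all large `n` (`E₀(v) < ∞`): the limit profile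
of `exists_limitProfile` (Rellich + Fatou + Beppo Levi) has maximal-form energy `≤ supₙ E₀(min(v,n))`.
This is `truncationLimit_of_maxFormBound` of the sibling crux with its hypothesis localised. [folklore] -/
theorem truncationLimit_at_of_maxFormBound_at {v : ℝ → ℝ≥0∞} (hv : IsRepulsiveFiniteRange v) {N : ℕ} {L : ℝ}
    (hL : 0 < L)
    (hcore : ∀ η : Lp ℂ 2 (volume : Measure (UnitAddTorus (Fin N × Fin 3))), ‖η‖ = 1 →
        (∀ (σ : Equiv.Perm (Fin N)) (n : Fin N × Fin 3 → ℤ),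
          ⟪(mFourierLp 2 (fun p : Fin N × Fin 3 => n (σ p.1, p.2)) :
              Lp ℂ 2 (volume : Measure (UnitAddTorus (Fin N × Fin 3)))), η⟫_ℂ =
            ⟪(mFourierLp 2 n : Lp ℂ 2 (volume : Measure (UnitAddTorus (Fin N × Fin 3)))), η⟫_ℂ) →
        periodicGroundStateEnergy v N L ≤
          ∑' n : Fin N × Fin 3 → ℤ, ENNReal.ofReal (∑ p, (2 * Real.pi * (n p : ℝ) / L) ^ 2) *
              (‖⟪(mFourierLp 2 n : Lp ℂ 2 (volume : Measure (UnitAddTorus (Fin N × Fin 3)))), η⟫_ℂ‖₊ :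
                ℝ≥0∞) ^ 2 +
            ∫⁻ t, periodicInteraction v L (fromUnitTorusN L t) *
              (‖(η : UnitAddTorus (Fin N × Fin 3) → ℂ) t‖₊ : ℝ≥0∞) ^ 2)
    (hfin : periodicGroundStateEnergy v N L ≠ ⊤) {ε : ℝ} (hε : 0 < ε) :
    ∃ n₁ : ℕ, ∀ n : ℕ, n₁ ≤ n →
      (periodicGroundStateEnergy v N L).toReal ≤
        (periodicGroundStateEnergy (truncPotential v n) N L).toReal + ε := by
  set E : ℕ → ℝ≥0∞ := fun n => periodicGroundStateEnergy (truncPotential v n) N L with hE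
  have hsup_le : (⨆ n, E n) ≤ periodicGroundStateEnergy v N L :=
    iSup_le fun n => periodicGroundStateEnergy_truncPotential_le' v n N L
  have hsup_ne : (⨆ n, E n) ≠ ⊤ := ne_top_of_le_ne_top hfin hsup_le
  obtain ⟨η, hη1, hηsymm, hηE⟩ := exists_limitProfile hv.1 hL hsup_ne
  have hge : periodicGroundStateEnergy v N L ≤ ⨆ n, E n := (hcore η hη1 hηsymm).trans hηE
  have htend : Tendsto (fun n => (E n).toReal) atTop (𝓝 (⨆ n, E n).toReal) :=
    (ENNReal.tendsto_toReal hsup_ne).comp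
      (tendsto_atTop_iSup (monotone_periodicGroundStateEnergy_truncPotential v N L))
  obtain ⟨n₁, hn₁⟩ := eventually_atTop.1 (htend.eventually (Ioi_mem_nhds (sub_lt_self _ hε)))
  refine ⟨n₁, fun n hn => ?_⟩
  have h1 : (periodicGroundStateEnergy v N L).toReal ≤ (⨆ n, E n).toReal := ENNReal.toReal_mono hsup_ne hge
  have h2 : (⨆ n, E n).toReal - ε < (E n).toReal := hn₁ n hn
  change (periodicGroundStateEnergy v N L).toReal ≤ (E n).toReal + ε
  linarith

/-! ### The truncation limit for integrable interactions -/

/-- **`TruncationLimit` at `(v, N, L)` for an integrable periodic interaction**: if `v` is admissible, `L > 0`,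
`∫_{[0,L)^{3N}} ∑_{i<j} v^per(xᵢ - xⱼ) dX < ∞` and `E₀(v) < ∞`, then `E₀(v) ≤ E₀(min(v,n)) + ε` for all large `n`
(`periodicGroundStateEnergy_le_maxForm` + `truncationLimit_at_of_maxFormBound_at`). [folklore] -/
theorem truncationLimit_at_of_integrable {v : ℝ → ℝ≥0∞} (hv : IsRepulsiveFiniteRange v) {N : ℕ} {L : ℝ}
    (hL : 0 < L) (hWint : ∫⁻ X in cellN N L, periodicInteraction v L X ≠ ⊤)
    (hfin : periodicGroundStateEnergy v N L ≠ ⊤) {ε : ℝ} (hε : 0 < ε) :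
    ∃ n₁ : ℕ, ∀ n : ℕ, n₁ ≤ n →
      (periodicGroundStateEnergy v N L).toReal ≤
        (periodicGroundStateEnergy (truncPotential v n) N L).toReal + ε :=
  truncationLimit_at_of_maxFormBound_at hv hL
    (fun η hη hsymm => periodicGroundStateEnergy_le_maxForm hL hv.1 hWint η hη hsymm) hfin hε

/-- **`TruncationLimit` at `(v, N, L)` for an integrable profile** `∫_{ℝ³} v(|z|) dz < ∞` (then the periodic
interaction is integrable on every cell, `lintegral_cellN_periodicInteraction_ne_top`). [folklore] -/
theorem truncationLimit_at_of_integrable_profile {v : ℝ → ℝ≥0∞} (hv : IsRepulsiveFiniteRange v)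
    (hint : (∫⁻ z : Space, v ‖z‖) ≠ ⊤) {N : ℕ} {L : ℝ} (hL : 0 < L)
    (hfin : periodicGroundStateEnergy v N L ≠ ⊤) {ε : ℝ} (hε : 0 < ε) :
    ∃ n₁ : ℕ, ∀ n : ℕ, n₁ ≤ n →
      (periodicGroundStateEnergy v N L).toReal ≤
        (periodicGroundStateEnergy (truncPotential v n) N L).toReal + ε :=
  truncationLimit_at_of_integrable hv hL
    (PeriodicIRBound.LinearPhFloorWagner.WF.lintegral_cellN_periodicInteraction_ne_top hL hv.1 hint N) hfin hε

/-! ### Registered-shape sub-goal: the stub for integrable profiles -/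

/-- **Sub-goal `stub_truncationLimit_integrable`** (item stmt-AtomisticToContinuum-9481, line
`force-balance-constitutive`, stub S4 `stub_truncationLimit : TruncationLimit`): the registered statement
`TruncationLimit` with the single extra hypothesis `∫⁻ z, v ‖z‖ ≠ ⊤` (integrable profile; covers all bounded and
all `L¹` finite-range repulsive potentials). The remaining case — hard cores / non-`L¹` shells with `E₀(v) < ∞` —
is exactly `MaxFormBound` at such `v` (hypothesis `hcore` of `truncationLimit_at_of_maxFormBound_at`). [folklore] -/
theorem stub_truncationLimit_integrable :
    ∀ v : ℝ → ℝ≥0∞, IsRepulsiveFiniteRange v → (∫⁻ z : Space, v ‖z‖) ≠ ⊤ → ∀ (N : ℕ) (L : ℝ), 0 < L →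
      periodicGroundStateEnergy v N L ≠ ⊤ →
      ∀ ε : ℝ, 0 < ε → ∃ n₁ : ℕ, ∀ n : ℕ, n₁ ≤ n →
        (periodicGroundStateEnergy v N L).toReal ≤
          (periodicGroundStateEnergy (truncPotential v n) N L).toReal + ε :=
  fun _v hv hint _N _L hL hfin _ε hε => truncationLimit_at_of_integrable_profile hv hint hL hfin hε

/-! ### What remains: `TruncationLimit` from the maximal-form bound for NON-integrable interactions only -/

/-- **The registered stub `TruncationLimit` follows from `MaxFormBound` restricted to the non-integrable case**
(`∫_{[0,L)^{3N}} W = ∞`, i.e. hard cores / non-`L¹` shells, with `E₀(v) < ∞`): the integrable case is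
`truncationLimit_at_of_integrable`. This kernel-checks that the hypothesis below is EXACTLY the remaining gap of
stub S4. [folklore] -/
theorem truncationLimit_of_maxFormBound_nonintegrable
    (hcore : ∀ v : ℝ → ℝ≥0∞, IsRepulsiveFiniteRange v → ∀ (N : ℕ) (L : ℝ), 0 < L →
      (∫⁻ X in cellN N L, periodicInteraction v L X) = ⊤ → periodicGroundStateEnergy v N L ≠ ⊤ →
      ∀ η : Lp ℂ 2 (volume : Measure (UnitAddTorus (Fin N × Fin 3))), ‖η‖ = 1 →
        (∀ (σ : Equiv.Perm (Fin N)) (n : Fin N × Fin 3 → ℤ),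
          ⟪(mFourierLp 2 (fun p : Fin N × Fin 3 => n (σ p.1, p.2)) :
              Lp ℂ 2 (volume : Measure (UnitAddTorus (Fin N × Fin 3)))), η⟫_ℂ =
            ⟪(mFourierLp 2 n : Lp ℂ 2 (volume : Measure (UnitAddTorus (Fin N × Fin 3)))), η⟫_ℂ) →
        periodicGroundStateEnergy v N L ≤
          ∑' n : Fin N × Fin 3 → ℤ, ENNReal.ofReal (∑ p, (2 * Real.pi * (n p : ℝ) / L) ^ 2) *
              (‖⟪(mFourierLp 2 n : Lp ℂ 2 (volume : Measure (UnitAddTorus (Fin N × Fin 3)))), η⟫_ℂ‖₊ :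
                ℝ≥0∞) ^ 2 +
            ∫⁻ t, periodicInteraction v L (fromUnitTorusN L t) *
              (‖(η : UnitAddTorus (Fin N × Fin 3) → ℂ) t‖₊ : ℝ≥0∞) ^ 2) :
    TruncationLimit := by
  intro v hv N L hL hfin ε hε
  by_cases hW : (∫⁻ X in cellN N L, periodicInteraction v L X) = ⊤
  · exact truncationLimit_at_of_maxFormBound_at hv hL (hcore v hv N L hL hW hfin) hfin hε
  · exact truncationLimit_at_of_integrable hv hL hW hfin hε

end Summit.AtomisticToContinuum.BoseEinsteinCondensation.Cruxes.DensityResponse.ForceBalanceConstitutive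

end
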